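import Literature.AlgebraicGeometry.AbelianSchemes.PolarizationHasTypeOfIsogenyQuotient
import Literature.AlgebraicGeometry.AbelianSchemes.AbelianSchemeDualIsogeny
import Literature.AlgebraicGeometry.AbelianSchemes.IsLambdaOfAtAlongIsogeny
import HarnessLib

/-!
# `HasType δ` of the descended polarisation — the instantiation for an isogeny `u : A → B` with its DUAL ISOGENY `u^∨`

Topic `AlgebraicGeometry/AbelianSchemes`; namespace `Literature.AlgebraicGeometry.AbelianSchemes.AbelianSchemeOver`.
THEOREMS ONLY (no definition, no named fact, no instance, no notation, no `sorry`; net Literature debt 0).  Cell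
hodgecm-mathlib (D-0151), HECKE-LINK line, socket (B) — the `hasType` FIELD of the quotient triple `Q` for `B := A′/K`
(B-plan1 (g14) 22:24:15Z (2) / (g15) 23:08:58Z (1)): ★ `Polarization.hasType_of_fibreIsogenyData`
(`PolarizationHasTypeOfIsogenyQuotient`, the finite-group transport) READ in the binder shapes the (O-y) assembler already
carries for ★ `LevelStructure.IsSymplecticLiftable.of_fibreIsogeny_of_dualIsogeny` (`SymplecticLiftOfIsogenyQuotient`):
the homomorphism `u : A.X ⟶ B.X`, the polarisations `polA`, `polB`, the dual isogeny ★ `DualPair.dualIsogenyOver u DA DB`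
(`AbelianSchemeDualIsogeny`) and the descended-polarisation identity **`hb : u ≫ polB.lam ≫ u^∨ = polA.lam ^ ν`**
(★ `comp_polarizationDesc_comp_dualIsogenyOver…`, `AbelianSchemeQuotientPolarizationIdentity(Reduced)`), plus per-point data
(onto on `Ω`-points, `ν`-divisibility, the two kernel counts, coprimality with `∏ δᵢ`).

* `algPointsMap_dualIsogeny_lam_eq_pow` — THE POINTS BRIDGE: `hb` read on `Ω`-points of the fibres,
  `u^∨_s (λ_{B,s} (u_s a)) = (λ_{A,s} a) ^ ν` (★ `fibrePointToLeft_map_fibreHom` ×3 + ★ `fibrePointToLeft_pow` +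
  ★ `fibrePointToLeft_injective`; `polA.lam ^ ν = polA.lam ≫ (𝟙)^ν` by `MonObj.comp_pow`);
* **`Polarization.hasType_of_fibreIsogeny_of_dualIsogeny`** — `polA.HasType δ ⇒ polB.HasType δ` under `hb` and the per-point
  data ([MumfordAV1970] §23 Thm. 2 / §7 Thm. 4; [MumfordFogartyKirwan1994] App. 7A: the type is read on the kernel of `λ̄` at
  geometric points);
* (ed. 2) **`Polarization.hasType_of_fibreIsogeny_of_dualIsogeny_of_coprime`** — the same with the two per-point coprimality
  conjuncts replaced by ONE global `Nat.Coprime ν (∏ δᵢ)` (socket (B) text v8's `Nat.Coprime (N′/N) (∏ i, δ i)`, B-plan1 (g15)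
  23:33:35Z) and the per-point `|A_s[ν](Ω)| = ν ^ k` (★ `natCard_ker_powMonoidHom_eq`): both kernel orders divide `ν ^ k`.

Discharge of the per-point binders by the cell's ★ (for the assembler): `hsurj` = ★ (i) `quotientBy_ontoFibres` in `AlgPoints`
currency (B-p04's bridge) · `hlamB` = «a polarisation is onto on geometric points» (B-p02 (D1)/(D2), B-p19 (b0) at `ℂ`) ·
`hdiv` = ★ `AlgPointsMapSurjectiveAlgClosed` / `zsmul_surjective_geomPoints`-type · the counts = ★ `natCard_ker_powMonoidHom_eq`
(`|A_s[ν](Ω)| = ν^{2 dim}`) with `|ker u_s| · |ker u^∨_s| = ν^{2g}` ((SYM-n), B-p05) · coprimality = ★ p741618 / the ℓ-adic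
convention `Nat.Coprime ν (N·∏δᵢ)`.  HC_CM is proved only modulo the 7 printed citations until rung 0 closes; this file
discharges none of them.

## References
* [MumfordAV1970] D. Mumford, *Abelian Varieties* (1970), §7 Thm. 4 (p. 72), §15 Thm. 1 (p. 143), §23 Thm. 2 (p. 231).
* [MumfordFogartyKirwan1994] D. Mumford, J. Fogarty, F. Kirwan, *Geometric Invariant Theory*, 3rd ed. (1994), Ch. 6 §2 Def. 6.3
  (p. 120), App. 7A (pp. 234–235).
* [MilneAV2008] J. S. Milne, *Abelian Varieties* (2008), I Prop. 7.1 and §8.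
-/

set_option autoImplicit false

noncomputable section

universe u

open CategoryTheory AlgebraicGeometry

namespace Literature.AlgebraicGeometry.AbelianSchemes

namespace AbelianSchemeOver

open Literature.AlgebraicGeometry.Motives
open scoped MonObj

variable {S : Scheme.{u}} {A B : AbelianSchemeOver S}

/-- **`hb` on points: `u^∨_s (λ_{B,s} (u_s a)) = (λ_{A,s} a) ^ ν`** for `hb : u ≫ λ_B ≫ u^∨ = λ_A ^ ν` — the three fibre
homomorphisms composed on an `Ω`-point lie over `a ≫ u ≫ λ_B ≫ u^∨ = a ≫ λ_A ≫ [ν]`, and the `ν`-th power of a fibre point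
lies over `· ≫ [ν]`. [cite: MumfordFogartyKirwan1994, Ch. 6 §2 Definition 6.3 (p. 120)] [cite: MumfordAV1970, §23 Thm. 2 (p. 231)] -/
theorem algPointsMap_dualIsogeny_lam_eq_pow {DA : A.DualPair} {DB : B.DualPair} (lamA : A.X ⟶ DA.hat.X)
    (lamB : B.X ⟶ DB.hat.X) [IsMonHom lamA] [IsMonHom lamB] (u : A.X ⟶ B.X) [IsMonHom u]
    [IsMonHom (DualPair.dualIsogenyOver u DA DB)] (ν : ℕ) (hb : u ≫ lamB ≫ DualPair.dualIsogenyOver u DA DB = lamA ^ ν)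
    {Ω : Type u} [Field Ω] (s : Spec (.of Ω) ⟶ S) (a : (A.fibre s).toAbelianVariety.Points Ω) :
    AlgPoints.map (fibreHom (DualPair.dualIsogenyOver u DA DB) s).hom.hom.hom
        (AlgPoints.map (fibreHom lamB s).hom.hom.hom (AlgPoints.map (fibreHom u s).hom.hom.hom a)) =
      AlgPoints.map (fibreHom lamA s).hom.hom.hom a ^ ν := by
  apply DA.hat.fibrePointToLeft_injective s
  have hpow : lamA ^ ν = lamA ≫ (𝟙 DA.hat.X) ^ ν := by
    rw [MonObj.comp_pow, Category.comp_id]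
  rw [fibrePointToLeft_map_fibreHom, fibrePointToLeft_map_fibreHom, fibrePointToLeft_map_fibreHom,
    fibrePointToLeft_pow, fibrePointToLeft_map_fibreHom, Category.assoc, Category.assoc, Category.assoc,
    ← Over.comp_left, ← Over.comp_left, hb, hpow, Over.comp_left]
  simp only [Category.assoc]

/-- **H2c INSTANTIATED — `HasType δ` OF THE DESCENDED POLARISATION through an isogeny `u : A → B` with its dual isogeny `u^∨`
and the identity `u ≫ λ_B ≫ u^∨ = λ_A ^ ν`.**  Per geometric point `s : Spec Ω → S` the assembler supplies: `u_s` and `λ_{B,s}`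
onto on `Ω`-points, `ν`-divisibility of `A_s(Ω)`, finite kernels of `u_s` and `u^∨_s` with
`|A_s[ν](Ω)| = |ker u_s| · |ker u^∨_s|`, both kernel orders prime to `∏ δᵢ`.  Then `polA.HasType δ → polB.HasType δ`
(★ `Polarization.hasType_of_fibreIsogenyData` with `ψ := u_s`, `ψ^∨ := u^∨_s` on points and `hcomp` from
`algPointsMap_dualIsogeny_lam_eq_pow`). [cite: MumfordAV1970, §23 Thm. 2 (p. 231) and §7 Thm. 4 (p. 72)]
[cite: MumfordFogartyKirwan1994, App. 7A (pp. 234–235)] [cite: MilneAV2008, I Prop. 7.1 and §8] -/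
theorem Polarization.hasType_of_fibreIsogeny_of_dualIsogeny {DA : A.DualPair} {DB : B.DualPair}
    (polA : A.Polarization DA) (polB : B.Polarization DB) [IsMonHom polA.lam] [IsMonHom polB.lam]
    (u : A.X ⟶ B.X) [IsMonHom u] [IsMonHom (DualPair.dualIsogenyOver u DA DB)] (ν : ℕ) {g : ℕ} {δ : Fin g → ℕ}
    (hb : u ≫ polB.lam ≫ DualPair.dualIsogenyOver u DA DB = polA.lam ^ ν) (hT : polA.HasType δ)
    (hsurj : ∀ (Ω : Type u) [Field Ω] [IsAlgClosed Ω] (s : Spec (.of Ω) ⟶ S),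
      Function.Surjective (AlgPoints.map (L := Ω) (fibreHom u s).hom.hom.hom))
    (hlamB : ∀ (Ω : Type u) [Field Ω] [IsAlgClosed Ω] (s : Spec (.of Ω) ⟶ S),
      Function.Surjective (AlgPoints.map (L := Ω) (fibreHom polB.lam s).hom.hom.hom))
    (hdiv : ∀ (Ω : Type u) [Field Ω] [IsAlgClosed Ω] (s : Spec (.of Ω) ⟶ S),
      Function.Surjective (fun a : (A.fibre s).toAbelianVariety.Points Ω => a ^ ν))
    (hker : ∀ (Ω : Type u) [Field Ω] [IsAlgClosed Ω] (s : Spec (.of Ω) ⟶ S),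
      Finite (IsMonHom.monoidHom (fibreHom u s).hom.hom.hom (specOver Ω Ω)).ker ∧
      Finite (IsMonHom.monoidHom (fibreHom (DualPair.dualIsogenyOver u DA DB) s).hom.hom.hom (specOver Ω Ω)).ker ∧
      Nat.card (powMonoidHom ν : (A.fibre s).toAbelianVariety.Points Ω →* _).ker =
        Nat.card (IsMonHom.monoidHom (fibreHom u s).hom.hom.hom (specOver Ω Ω)).ker *
          Nat.card (IsMonHom.monoidHom (fibreHom (DualPair.dualIsogenyOver u DA DB) s).hom.hom.hom (specOver Ω Ω)).ker ∧
      Nat.Coprime (Nat.card (IsMonHom.monoidHom (fibreHom u s).hom.hom.hom (specOver Ω Ω)).ker) (∏ i, δ i) ∧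
      Nat.Coprime
        (Nat.card (IsMonHom.monoidHom (fibreHom (DualPair.dualIsogenyOver u DA DB) s).hom.hom.hom (specOver Ω Ω)).ker)
        (∏ i, δ i)) :
    polB.HasType δ := by
  refine Polarization.hasType_of_fibreIsogenyData polA polB hT fun Ω _ _ s => ?_
  obtain ⟨hfin, hfind, hcount, hcop, hcopd⟩ := hker Ω s
  refine ⟨IsMonHom.monoidHom (fibreHom u s).hom.hom.hom (specOver Ω Ω),
    IsMonHom.monoidHom (fibreHom (DualPair.dualIsogenyOver u DA DB) s).hom.hom.hom (specOver Ω Ω), ν,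
    fun a => ?_, hsurj Ω s, hlamB Ω s, hdiv Ω s, hfin, hfind, hcount, hcop, hcopd⟩
  exact algPointsMap_dualIsogeny_lam_eq_pow polA.lam polB.lam u ν hb s a

/-- **H2c with ONE GLOBAL COPRIMALITY `Nat.Coprime ν (∏ δᵢ)`** (socket (B) text v8): as
`hasType_of_fibreIsogeny_of_dualIsogeny`, but per point only the finiteness of the two kernels, the product law
`|A_s[ν](Ω)| = |ker u_s| · |ker u^∨_s|` and `|A_s[ν](Ω)| = ν ^ k` for some `k` are asked — both kernel orders then divide
`ν ^ k`, hence are prime to `∏ δᵢ`. [cite: MumfordAV1970, §23 Thm. 2 (p. 231) and §7 Thm. 4 (p. 72)]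
[cite: MumfordFogartyKirwan1994, App. 7A (pp. 234–235)] -/
theorem Polarization.hasType_of_fibreIsogeny_of_dualIsogeny_of_coprime {DA : A.DualPair} {DB : B.DualPair}
    (polA : A.Polarization DA) (polB : B.Polarization DB) [IsMonHom polA.lam] [IsMonHom polB.lam]
    (u : A.X ⟶ B.X) [IsMonHom u] [IsMonHom (DualPair.dualIsogenyOver u DA DB)] (ν : ℕ) {g : ℕ} {δ : Fin g → ℕ}
    (hb : u ≫ polB.lam ≫ DualPair.dualIsogenyOver u DA DB = polA.lam ^ ν) (hT : polA.HasType δ)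
    (hcop : Nat.Coprime ν (∏ i, δ i))
    (hsurj : ∀ (Ω : Type u) [Field Ω] [IsAlgClosed Ω] (s : Spec (.of Ω) ⟶ S),
      Function.Surjective (AlgPoints.map (L := Ω) (fibreHom u s).hom.hom.hom))
    (hlamB : ∀ (Ω : Type u) [Field Ω] [IsAlgClosed Ω] (s : Spec (.of Ω) ⟶ S),
      Function.Surjective (AlgPoints.map (L := Ω) (fibreHom polB.lam s).hom.hom.hom))
    (hdiv : ∀ (Ω : Type u) [Field Ω] [IsAlgClosed Ω] (s : Spec (.of Ω) ⟶ S),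
      Function.Surjective (fun a : (A.fibre s).toAbelianVariety.Points Ω => a ^ ν))
    (hker : ∀ (Ω : Type u) [Field Ω] [IsAlgClosed Ω] (s : Spec (.of Ω) ⟶ S),
      Finite (IsMonHom.monoidHom (fibreHom u s).hom.hom.hom (specOver Ω Ω)).ker ∧
      Finite (IsMonHom.monoidHom (fibreHom (DualPair.dualIsogenyOver u DA DB) s).hom.hom.hom (specOver Ω Ω)).ker ∧
      Nat.card (powMonoidHom ν : (A.fibre s).toAbelianVariety.Points Ω →* _).ker =
        Nat.card (IsMonHom.monoidHom (fibreHom u s).hom.hom.hom (specOver Ω Ω)).ker *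
          Nat.card (IsMonHom.monoidHom (fibreHom (DualPair.dualIsogenyOver u DA DB) s).hom.hom.hom (specOver Ω Ω)).ker ∧
      ∃ k : ℕ, Nat.card (powMonoidHom ν : (A.fibre s).toAbelianVariety.Points Ω →* _).ker = ν ^ k) :
    polB.HasType δ := by
  refine Polarization.hasType_of_fibreIsogeny_of_dualIsogeny polA polB u ν hb hT hsurj hlamB hdiv fun Ω _ _ s => ?_
  obtain ⟨hfin, hfind, hcount, k, hk⟩ := hker Ω s
  have hcopk : Nat.Coprime (ν ^ k) (∏ i, δ i) := Nat.Coprime.pow_left k hcop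
  refine ⟨hfin, hfind, hcount, ?_, ?_⟩
  · exact Nat.Coprime.coprime_dvd_left (Dvd.intro _ (hcount.symm.trans hk)) hcopk
  · exact Nat.Coprime.coprime_dvd_left (Dvd.intro_left _ (hcount.symm.trans hk)) hcopk

end AbelianSchemeOver

end Literature.AlgebraicGeometry.AbelianSchemes

end
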